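import Summits.HodgeConjecture.HodgeConjecture.Theorems.WeilTypeLadderCombPieces
import HarnessLib

/-!
# WeilTypeLadder · THEOREM DISC-NORM, algebraic steps: the tridiagonal determinant recursion of the twisted intersection matrix,
# and the telescoping of the comb pieces (multiplicative leg bookkeeping)

b2b cell `hweil` (packet `run/shared/lean/b2b/hodge-weil/`, report `b2b-hweil-pv3-g40/COMB-PIECES.md` §3.6, prover 3 generation 40).
PURE ALGEBRA (a field resp. a commutative monoid), no geometry, no named fact; sibling of `Theorems/WeilTypeLadderCombPieces`.

THEOREM DISC-NORM of the packet: the discriminant class over an imaginary quadratic `K ⊂ ℚ(ζ_m)` of the `ζ_m`-primitive Prym of the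
cyclic cover `y^m = Π (x − bᵢ)^{βᵢ}` is `((2m)^ℓ d_{E/K})^N · Nm_{E/K}(δ^{N−2} Πᵢ (1 − ζ_m^{βᵢ}))`. Two algebraic steps of its proof are
typed here.

(1) **The determinant induction.** On the basis of regularised intervals the intersection matrix of the rank-one twisted homology of
`ℙ¹ ∖ {b₁, …, b_N}` is tridiagonal (Aomoto–Kita, *Theory of Hypergeometric Functions* (2011) §2.3.3, p. 107) with diagonal
`(c_j c_{j+1} − 1)/((c_j − 1)(c_{j+1} − 1))` and with the product of the two off-diagonal entries in position `(j, j+1)` equal to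
`c_{j+1}/(c_{j+1} − 1)²` (`c_j` the local monodromies, all `≠ 1`). Expanding along the last row, its leading principal minors satisfy
`D_{k+2} = t_{k+2} D_{k+1} − u_{k+2} D_k`; `tridiagDet_closed_form` proves the closed form
`D_k = (c₁ c₂ ⋯ c_{k+1} − 1) / Πⱼ≤k+1 (c_j − 1)` for every sequence satisfying this recursion (the key polynomial identity is
`tridiag_numerator_identity`). With `c₁ ⋯ c_N = 1` this is `±(c_N⁻¹ − 1)/Π_{j<N}(c_j − 1)`, i.e. `∓ Π_j (1 − c_j⁻¹)` modulo the positive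
norms `|1 − c_j|²` — the source of the product `Πᵢ (1 − ζ^{βᵢ})`.

(2) **The telescoping of the comb pieces.** For a list `l` (the rotation numbers in a compact ordering) with prefix sums `s_k` and any
map `f` into a commutative monoid, the product over the `N − 2` pieces `(s_{k−1}, β_k, −s_k)` of `f` of the three legs equals
`Πᵢ f(βᵢ) · Π_{2 ≤ k ≤ N−2} f(s_k) f(−s_k)` when `l.sum = 0` (`combPieces_prod_legs_eq`) — the multiplicative form of
`combPieces_legs_count_eq` of the sibling file; with `f(x) = 1 − ζ^x` the inner factors are the norms `(1 − ζ^{s})(1 − ζ^{−s})`, which is how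
THEOREM DISC-PIECES (product over pieces) turns into THEOREM DISC-NORM (product over the letters).

HONEST LABEL: algebraic bookkeeping for a pen-and-paper theorem of the packet (whose geometric inputs — twisted homology, the
Aomoto–Kita matrix, the `E → K` transfer — are cited there, not typed); 0 rungs; nothing of Markman 2025 / Mostaed 2026 / Perry 2026.
-/

-- every declaration of this problem lives in `Summit.HodgeConjecture.HodgeConjecture.…` (summit = sub-problem)
set_option linter.dupNamespace false

namespace Summit.HodgeConjecture.HodgeConjecture.WeilTypeLadder

section TridiagDet

variable {F : Type*} [Field F]

/-- **The numerator identity of the induction step** (polynomial identity, every commutative ring would do):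
`(c_k c_{k+1} − 1)(P c_k − 1) − c_k (c_{k+1} − 1)(P − 1) = (c_k − 1)(P c_k c_{k+1} − 1)` with `P = c₁ ⋯ c_{k−1}`. [folklore] -/
theorem tridiag_numerator_identity (P a b : F) :
    (a * b - 1) * (P * a - 1) - a * (b - 1) * (P - 1) = (a - 1) * (P * a * b - 1) := by
  ring

/-- **Closed form of the tridiagonal determinant recursion.** Let `c : ℕ → F` with `c j ≠ 1` for all `j`, and let `D : ℕ → F` satisfy
`D 0 = 1`, `D 1 = (c 1 * c 2 − 1)/((c 1 − 1)(c 2 − 1))` and, for all `k`,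
`D (k+2) = (c (k+2) c (k+3) − 1)/((c (k+2) − 1)(c (k+3) − 1)) · D (k+1) − c (k+2)/(c (k+2) − 1)² · D k`
(the expansion of the `(k+2) × (k+2)` leading minor of the Aomoto–Kita intersection matrix along its last row). Then
`D k = (Π_{j=1}^{k+1} c j − 1) / Π_{j=1}^{k+1} (c j − 1)` for every `k`. [cite: AomotoKita2011, §2.3.3 (p. 107)] -/
theorem tridiagDet_closed_form (c D : ℕ → F) (hc : ∀ j, c j ≠ 1) (h0 : D 0 = 1)
    (h1 : D 1 = (c 1 * c 2 - 1) / ((c 1 - 1) * (c 2 - 1)))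
    (hrec : ∀ k, D (k + 2) = (c (k + 2) * c (k + 3) - 1) / ((c (k + 2) - 1) * (c (k + 3) - 1)) * D (k + 1)
      - c (k + 2) / (c (k + 2) - 1) ^ 2 * D k) :
    ∀ k, D k = ((∏ j ∈ Finset.Icc 1 (k + 1), c j) - 1) / ∏ j ∈ Finset.Icc 1 (k + 1), (c j - 1) := by
  have hd : ∀ j, c j - 1 ≠ 0 := fun j h => hc j (sub_eq_zero.mp h)
  have hprod : ∀ n, (∏ j ∈ Finset.Icc 1 n, (c j - 1)) ≠ 0 := fun n => Finset.prod_ne_zero_iff.mpr fun j _ => hd j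
  -- strong induction, two base cases
  intro k
  induction k using Nat.strong_induction_on with
  | _ k ih =>
    match k with
    | 0 =>
      rw [h0]
      simp only [zero_add, Finset.Icc_self, Finset.prod_singleton]
      rw [div_self (hd 1)]
    | 1 =>
      rw [h1]
      have e : Finset.Icc 1 (1 + 1) = {1, 2} := by decide
      rw [e, Finset.prod_pair (by norm_num), Finset.prod_pair (by norm_num)]
    | k + 2 =>
      rw [hrec k, ih (k + 1) (by omega), ih k (by omega)]
      -- split the products at the top: Icc 1 (k+3) = Icc 1 (k+1) ∪ {k+2, k+3}, Icc 1 (k+2) = Icc 1 (k+1) ∪ {k+2}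
      have s2 : ∀ (g : ℕ → F), ∏ j ∈ Finset.Icc 1 (k + 1 + 1), g j = (∏ j ∈ Finset.Icc 1 (k + 1), g j) * g (k + 2) := by
        intro g
        rw [Finset.prod_Icc_succ_top (by omega) g]
      have s3 : ∀ (g : ℕ → F), ∏ j ∈ Finset.Icc 1 (k + 2 + 1), g j
          = (∏ j ∈ Finset.Icc 1 (k + 1), g j) * g (k + 2) * g (k + 3) := by
        intro g
        show ∏ j ∈ Finset.Icc 1 (k + 1 + 1 + 1), g j = _
        rw [Finset.prod_Icc_succ_top (by omega) g, Finset.prod_Icc_succ_top (by omega) g]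
      rw [s2 c, s2 (fun j => c j - 1), s3 c, s3 (fun j => c j - 1)]
      set P := ∏ j ∈ Finset.Icc 1 (k + 1), c j with hP
      set Q := ∏ j ∈ Finset.Icc 1 (k + 1), (c j - 1) with hQ
      have hQ0 : Q ≠ 0 := hprod (k + 1)
      have ha : c (k + 2) - 1 ≠ 0 := hd (k + 2)
      have hb : c (k + 3) - 1 ≠ 0 := hd (k + 3)
      field_simp
      ring

end TridiagDet

section CombPiecesTelescoping

variable {G : Type*} [AddCommGroup G] {M : Type*} [CommMonoid M]

/-- Product of a threefold pointwise product over a list = product of the three products (commutative monoid).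
[folklore] -/
theorem prod_map_mul_three {ι : Type*} (js : List ι) (a b c : ι → M) :
    (js.map (fun i => a i * b i * c i)).prod = (js.map a).prod * (js.map b).prod * (js.map c).prod := by
  rw [List.prod_map_mul, List.prod_map_mul]

/-- The middle legs as a function of the piece index, for lists in any additive group (the `ZMod m` case is
`drop_one_take_eq_map_getD` of the sibling file): `((l.drop 1).take (N-2))` is the list of `l[j+1]`, `j < N - 2`.
[folklore] -/
theorem drop_one_take_eq_map_getD_of_addCommGroup (l : List G) :
    (l.drop 1).take (l.length - 2) = (List.range (l.length - 2)).map (fun j => l.getD (j + 1) 0) := by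
  apply List.ext_getElem
  · simp; omega
  · intro i h1 h2
    simp only [List.length_take, List.length_drop] at h1
    simp only [List.getElem_take, List.getElem_drop, List.getElem_map, List.getElem_range,
      List.getD_eq_getElem?_getD]
    rw [List.getElem?_eq_getElem (by omega)]
    simp [add_comm]

/-- **Telescoping of the comb pieces (multiplicative leg bookkeeping; THEOREM DISC-PIECES ⟹ THEOREM DISC-NORM).**
Let `l = [β₁, …, β_N]` be a list in an additive commutative group with `N ≥ 3` and `l.sum = 0`, prefix sums
`s_k = (l.take k).sum`, and let `f` be any map into a commutative monoid. The `N - 2` comb pieces are the triples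
`(s_{j+1}, β_{j+2}, -s_{j+2})`, `j < N - 2`. Then
`Π_{j < N-2} f(s_{j+1}) f(β_{j+2}) f(-s_{j+2}) = (Πᵢ f(βᵢ)) · Π_{j < N-3} f(s_{j+2}) f(-s_{j+2})`:
the first legs are `β₁ = s₁, s₂, …, s_{N-2}`, the middle legs `β₂, …, β_{N-1}`, the last legs `-s₂, …, -s_{N-2}` and
`-s_{N-1} = β_N` (because `l.sum = 0`), so every INNER prefix sum `s_k` (`2 ≤ k ≤ N-2`) contributes the pair
`f(s_k) f(-s_k)` and the letters contribute `Πᵢ f(βᵢ)`. With `f(x) = 1 - ζ^x` (in `ℚ(ζ_m)`, `x ∈ ℤ/m`) the inner pairs are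
the norms `(1 - ζ^{s})(1 - ζ^{-s}) = N_{E/E⁺}(1 - ζ^{s})`, which is how the product of the piece classes
`Nm_{E/K}(δ(1-ζ^a)(1-ζ^b)(1-ζ^c))` of THEOREM DISC-PIECES collapses to `Nm_{E/K}(δ^{N-2} Πᵢ (1 - ζ^{βᵢ}))` modulo norms —
THEOREM DISC-NORM (report `b2b-hweil-pv3-g40/COMB-PIECES.md` §3.6 (b)(vi); this is the lemma announced in this file's
header as (2), landed by prover 3 generation 41). [folklore] -/
theorem combPieces_prod_legs_eq (f : G → M) (l : List G) (hl : 3 ≤ l.length) (hs : l.sum = 0) :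
    ((List.range (l.length - 2)).map (fun j =>
        f ((l.take (j + 1)).sum) * f (l.getD (j + 1) 0) * f (-(l.take (j + 2)).sum))).prod
      = (l.map f).prod * ((List.range (l.length - 3)).map (fun j =>
          f ((l.take (j + 2)).sum) * f (-(l.take (j + 2)).sum))).prod := by
  obtain ⟨n, hn⟩ : ∃ n, l.length = n + 3 := ⟨l.length - 3, by omega⟩
  have e2 : l.length - 2 = n + 1 := by omega
  have e3 : l.length - 3 = n := by omega
  -- the middle legs are the letters `β₂ … β_{N-1}`
  have hmid : (List.range (n + 1)).map (fun j => f (l.getD (j + 1) 0)) = ((l.drop 1).take (n + 1)).map f := by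
    have h := drop_one_take_eq_map_getD_of_addCommGroup l
    rw [e2] at h
    rw [h, List.map_map]
    rfl
  -- first legs = `s₁ :: (s₂ … s_{N-2})`
  have hfirst : (List.range (n + 1)).map (fun j => f ((l.take (j + 1)).sum))
      = f ((l.take 1).sum) :: (List.range n).map (fun j => f ((l.take (j + 2)).sum)) := by
    rw [List.range_succ_eq_map, List.map_cons, List.map_map]
    rfl
  -- last legs = `(-s₂ … -s_{N-2}) ++ [-s_{N-1}]`
  have hlast : (List.range (n + 1)).map (fun j => f (-(l.take (j + 2)).sum))
      = (List.range n).map (fun j => f (-(l.take (j + 2)).sum)) ++ [f (-(l.take (n + 2)).sum)] := by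
    rw [List.range_succ, List.map_append, List.map_singleton]
  -- the letters: `l = [x] ++ middle ++ [y]`, `x = s₁`, `y = -s_{N-1}`
  have hsplit : l = l.take 1 ++ ((l.drop 1).take (n + 1) ++ l.drop (n + 2)) := by
    conv_lhs => rw [← List.take_append_drop 1 l, ← List.take_append_drop (n + 1) (l.drop 1)]
    rw [List.drop_drop, show 1 + (n + 1) = n + 2 by ring]
  obtain ⟨x, hx⟩ : ∃ x, l.take 1 = [x] := by
    have : (l.take 1).length = 1 := by simp; omega
    match h : l.take 1, this with
    | [a], _ => exact ⟨a, rfl⟩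
  obtain ⟨y, hy⟩ : ∃ y, l.drop (n + 2) = [y] := by
    have : (l.drop (n + 2)).length = 1 := by simp; omega
    match h : l.drop (n + 2), this with
    | [a], _ => exact ⟨a, rfl⟩
  have hprod : (l.map f).prod = f x * (((l.drop 1).take (n + 1)).map f).prod * f y := by
    conv_lhs => rw [hsplit]
    rw [List.map_append, List.map_append, List.prod_append, List.prod_append, hx, hy]
    simp [mul_assoc]
  have hsum : (l.take (n + 2)).sum + y = 0 := by
    have := List.sum_take_add_sum_drop l (n + 2)
    rw [hy, List.sum_singleton] at this
    rw [this, hs]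
  have ey : -(l.take (n + 2)).sum = y := add_eq_zero_iff_neg_eq.mp hsum
  have ex : (l.take 1).sum = x := by rw [hx, List.sum_singleton]
  rw [e2, e3, prod_map_mul_three, List.prod_map_mul, hmid, hfirst, hlast, List.prod_cons, List.prod_append,
    List.prod_singleton, hprod, ex, ey]
  ac_rfl

end CombPiecesTelescoping

end Summit.HodgeConjecture.HodgeConjecture.WeilTypeLadder
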